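import Literature.AnabelianGeometry.SemiGraphs.TemperedClosedRangeOfCofinal
import Literature.AnabelianGeometry.SemiGraphs.TemperedDecompositionSubgroupsProfinite
import HarnessLib

/-!
# `C_{Π^tp_𝔾}(Π^tp_ℍ) = Π^tp_ℍ` from the profinite side — commensurators pass to closures of images
# ([IUTchI] Prop. 2.2, third inclusion, for decomposition subgroups of a sub-semi-graph; [SemiAnbd] Cor. 2.7 (i))

Mochizuki, *Inter-universal Teichmüller theory I*, §2, Prop. 2.2 p. 45 («`Π^tp_ℍ ⊆ Π^tp_𝔾` … commensurably
terminal»; proof p. 46: from `C_{Π̂_𝔾}(Π̂_ℍ) = Π̂_ℍ` and `Π̂_ℍ ∩ Π^tp_𝔾 = Π^tp_ℍ`) [cite: Mochizuki2012, IUTchI Prop 2.2 p.45]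
(`[claim: Mochizuki2012, status: disputed]`; nothing of the series is asserted); Mochizuki, *Semi-graphs of
anabelioids* (2006), Cor. 2.7 (i) p. 30 [cite: MochizukiSemiAnbd2006, Cor. 2.7(i) p.30].

PROOF-ONLY file (abc-iut cell, layer L3, row «DECOMP-PROFINITE» sequel = sub-row (P2) of GAP row G-w5d028-2,
seat abc-iut-w5-d240 gen 6; no definition, no instance, no new named fact).

* §1 (topological groups, any continuous `ι : Γ → P`): `relIndex_topologicalClosure_map_ne_zero` (finite relative
  index survives closures of images), `topologicalClosure_map_conj_smul` (closure of the image of a conjugate is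
  the conjugate of the closure), **`map_mem_commensurator_topologicalClosure`** (`g ∈ C_Γ(D) ⟹ ι g ∈
  C_P(closure ι D)`), **`isCommensurablyTerminal_of_topologicalClosure_map`** (`C_P(closure ιD) = closure ιD` and
  `ι⁻¹(closure ιD) = D` ⟹ `C_Γ(D) = D`);
* §2 **`TemperedPiChart.isCommensurablyTerminal_range_of_isDecompHom_of_cofinal`** — (P2) for `Π^tp_ℍ = range φ`
  from (P3) (`TemperedDecompositionSubgroupsProfinite.lean`, [SemiAnbd] Cor. 2.7 (i) by name) and (P1)
  (`TemperedClosedRangeOfCofinal.lean`) at the chart model of the profinite completion; and abc-iut-w4-d052's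
  named target **`DecompSubgroupsCommensurablyTerminal c ℍ`** for ALL decomposition subgroups
  (`decompSubgroupsCommensurablyTerminal_of_isDecompHom_of_cofinal`, one conjugacy class).

HYPOTHESES DISPLAYED: `𝒢`, `𝒢_ℍ` finite coherent Prop-3.6 graphs, `𝒢` with a closed edge, the [IUTchI] p. 44
atoms `hq`/`hel`, and the ONE residual of the (P1) chain — COFINALITY of pulled-back open normal subgroups along
`φ` (every tempered covering of `𝒢_ℍ` dominated by a restricted one of `𝒢`).  Nothing here takes a side on
[IUTchIII] Cor. 3.12; typed ≠ proved for the [IUTchI] claim keys.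
-/

namespace Literature.AnabelianGeometry.SemiGraphs

open scoped Pointwise
open Topology

universe u v

/-! ### §1 Commensurators pass to closures of images -/

section Closures

variable {Γ : Type u} [Group Γ] {P : Type v} [Group P] [TopologicalSpace P] [IsTopologicalGroup P]
  (ι : Γ →* P)

/-- **Finite relative index survives closure of images**: if `K ≤ D` has finite index in `D`, then
`closure ι(K)` has finite index in `closure ι(D)` — `D` is a finite union of cosets `d K`, so `ι(D)` lies in
the CLOSED finite union of the `ι(d) · closure ι(K)` (step of [IUTchI] Prop. 2.2's «hence, also in `Π^tp_𝔾`»).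
[cite: Mochizuki2012, IUTchI Prop 2.2 p.46] -/
theorem relIndex_topologicalClosure_map_ne_zero {K D : Subgroup Γ} (hKD : K ≤ D) (hfi : K.relIndex D ≠ 0) :
    ((K.map ι).topologicalClosure).relIndex ((D.map ι).topologicalClosure) ≠ 0 := by
  classical
  set Khat := (K.map ι).topologicalClosure
  set Dhat := (D.map ι).topologicalClosure
  -- finitely many cosets of `K` in `D`
  haveI : (K.subgroupOf D).FiniteIndex := ⟨hfi⟩
  haveI : Finite (D ⧸ K.subgroupOf D) := Subgroup.finite_quotient_of_finiteIndex
  -- `ι(D)` is contained in the closed set `⋃_q ι(q.out) • Khat`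
  let F : Set P := ⋃ q : D ⧸ K.subgroupOf D, (fun p => ι (q.out : D) * p) '' (Khat : Set P)
  have hFclosed : IsClosed F := by
    refine isClosed_iUnion_of_finite fun q => ?_
    exact (Homeomorph.mulLeft (ι (q.out : D))).isClosedMap _ (Subgroup.isClosed_topologicalClosure _)
  have hDF : ((D.map ι : Subgroup P) : Set P) ⊆ F := by
    rintro _ ⟨d, hd, rfl⟩
    let q : D ⧸ K.subgroupOf D := QuotientGroup.mk ⟨d, hd⟩
    have hq : ((q.out : D) : Γ)⁻¹ * d ∈ K := by
      have := QuotientGroup.eq.1 (QuotientGroup.out_eq' q)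
      exact this
    refine Set.mem_iUnion.2 ⟨q, ⟨ι (((q.out : D) : Γ)⁻¹ * d), ?_, ?_⟩⟩
    · exact Subgroup.le_topologicalClosure _ (Subgroup.mem_map_of_mem _ hq)
    · simp only [map_mul, map_inv, mul_inv_cancel_left]
  have hDhatF : (Dhat : Set P) ⊆ F := by
    rw [Subgroup.topologicalClosure_coe]
    exact closure_minimal hDF hFclosed
  -- hence `Dhat / Khat` has at most as many elements as `D / K`
  have hKD' : Khat ≤ Dhat := Subgroup.topologicalClosure_mono (Subgroup.map_mono hKD)
  haveI : Finite (Dhat ⧸ Khat.subgroupOf Dhat) := by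
    refine Finite.of_surjective (fun q : D ⧸ K.subgroupOf D =>
      (QuotientGroup.mk ⟨ι (q.out : D), Subgroup.le_topologicalClosure _
        (Subgroup.mem_map_of_mem _ (q.out : D).2)⟩ : Dhat ⧸ Khat.subgroupOf Dhat)) ?_
    rintro ⟨x⟩
    rcases x with ⟨x, hx⟩
    obtain ⟨q, ⟨k, hk, hkx⟩⟩ := Set.mem_iUnion.1 (hDhatF hx)
    refine ⟨q, ?_⟩
    apply Eq.symm
    change (QuotientGroup.mk _ : Dhat ⧸ Khat.subgroupOf Dhat) = QuotientGroup.mk _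
    rw [QuotientGroup.eq]
    change ((⟨x, hx⟩ : Dhat) : P)⁻¹ * ι (q.out : D) ∈ Khat
    have : x⁻¹ * ι (q.out : D) = k⁻¹ := by rw [← hkx]; group
    rw [show ((⟨x, hx⟩ : Dhat) : P) = x from rfl, this]
    exact Khat.inv_mem hk
  exact Subgroup.index_ne_zero_of_finite

/-- **Closure of the image of a conjugate is the conjugate of the closure** (conjugation is a
homeomorphism). [cite: Mochizuki2012, IUTchI Prop 2.2 p.46] -/
theorem topologicalClosure_map_conj_smul (g : Γ) (D : Subgroup Γ) :
    ((ConjAct.toConjAct g • D).map ι).topologicalClosure =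
      ConjAct.toConjAct (ι g) • (D.map ι).topologicalClosure := by
  apply SetLike.coe_injective
  rw [Subgroup.topologicalClosure_coe, Subgroup.coe_pointwise_smul, Subgroup.topologicalClosure_coe,
    Subgroup.coe_map, Subgroup.coe_map, Subgroup.coe_pointwise_smul]
  have h1 : (ι : Γ → P) '' (ConjAct.toConjAct g • (D : Set Γ)) = ConjAct.toConjAct (ι g) • ((ι : Γ → P) '' D) := by
    ext p
    simp only [Set.mem_image, Set.mem_smul_set, ConjAct.smul_def, ConjAct.ofConjAct_toConjAct]
    constructor
    · rintro ⟨_, ⟨d, hd, rfl⟩, rfl⟩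
      exact ⟨ι d, ⟨d, hd, rfl⟩, by simp [map_mul, map_inv]⟩
    · rintro ⟨_, ⟨d, hd, rfl⟩, rfl⟩
      exact ⟨g * d * g⁻¹, ⟨d, hd, rfl⟩, by simp [map_mul, map_inv]⟩
  -- conjugation by `ι g` is a homeomorphism `e`, and `c • s = e '' s`
  let e : P ≃ₜ P := (Homeomorph.mulLeft (ι g)).trans (Homeomorph.mulRight (ι g)⁻¹)
  have he : ∀ s : Set P, ConjAct.toConjAct (ι g) • s = (e : P → P) '' s := fun s => by
    ext p
    simp only [Set.mem_smul_set, ConjAct.smul_def, ConjAct.ofConjAct_toConjAct, Set.mem_image, e,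
      Homeomorph.trans_apply, Homeomorph.coe_mulLeft, Homeomorph.coe_mulRight]
  rw [h1, he, he, e.image_closure]

/-- **Commensurators pass to closures of images**: if `g` commensurates `D` in `Γ`, then `ι g`
commensurates `closure ι(D)` in `P` ([IUTchI] Prop. 2.2 proof p. 46: `C_{Π̂_𝔾}(−)` controls `C_{Π^tp_𝔾}(−)`).
[cite: Mochizuki2012, IUTchI Prop 2.2 p.46] -/
theorem map_mem_commensurator_topologicalClosure {D : Subgroup Γ} {g : Γ}
    (hg : g ∈ Subgroup.Commensurable.commensurator D) :
    ι g ∈ Subgroup.Commensurable.commensurator ((D.map ι).topologicalClosure) := by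
  rw [Subgroup.Commensurable.commensurator_mem_iff] at hg ⊢
  rw [← topologicalClosure_map_conj_smul]
  set D' := ConjAct.toConjAct g • D
  -- `K := D' ⊓ D` has finite index in `D` and in `D'`
  have h1 : (D' ⊓ D).relIndex D ≠ 0 := by rw [Subgroup.inf_relIndex_right]; exact hg.1
  have h2 : (D' ⊓ D).relIndex D' ≠ 0 := by rw [Subgroup.inf_relIndex_left]; exact hg.2
  have h1' := relIndex_topologicalClosure_map_ne_zero ι inf_le_right h1
  have h2' := relIndex_topologicalClosure_map_ne_zero ι inf_le_left h2
  have hle : ((D' ⊓ D).map ι).topologicalClosure ≤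
      (D'.map ι).topologicalClosure ⊓ (D.map ι).topologicalClosure :=
    le_inf (Subgroup.topologicalClosure_mono (Subgroup.map_mono inf_le_left))
      (Subgroup.topologicalClosure_mono (Subgroup.map_mono inf_le_right))
  constructor
  · rw [← Subgroup.inf_relIndex_right]
    exact fun h => h1' (Subgroup.relIndex_eq_zero_of_le_left hle h)
  · rw [← Subgroup.inf_relIndex_left]
    exact fun h => h2' (Subgroup.relIndex_eq_zero_of_le_left hle h)

/-- **Commensurable terminality descends along `ι⁻¹(closure ι(D)) = D`**: if the closure of `ι(D)` is
commensurably terminal in `P` and pulls back to `D`, then `D` is commensurably terminal in `Γ` ([IUTchI] Prop. 2.2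
«[hence, also in `Π^tp_𝔾`]»). [cite: Mochizuki2012, IUTchI Prop 2.2 p.46] -/
theorem isCommensurablyTerminal_of_topologicalClosure_map {D : Subgroup Γ}
    (hhat : AbsoluteAnabelian.IsCommensurablyTerminal ((D.map ι).topologicalClosure))
    (hcl : ((D.map ι).topologicalClosure).comap ι = D) :
    AbsoluteAnabelian.IsCommensurablyTerminal D := by
  refine ⟨le_antisymm (fun g hg => ?_) (fun d hd => ?_)⟩
  · have h := map_mem_commensurator_topologicalClosure ι hg
    rw [hhat.commensurator_eq] at h
    rw [← hcl]
    exact h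
  · rw [Subgroup.Commensurable.commensurator_mem_iff]
    have : ConjAct.toConjAct d • D = D := by
      ext x
      rw [Subgroup.mem_pointwise_smul_iff_inv_smul_mem, ConjAct.smul_def]
      simp only [map_inv, ConjAct.ofConjAct_toConjAct, inv_inv]
      constructor
      · intro h
        have := D.mul_mem (D.mul_mem hd h) (D.inv_mem hd)
        simpa [mul_assoc] using this
      · intro h
        exact D.mul_mem (D.mul_mem (D.inv_mem hd) h) hd
    rw [this]

end Closures

/-! ### §2 [IUTchI] Prop. 2.2, third inclusion, for the decomposition subgroups — modulo cofinality -/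

namespace ProfiniteSemiGraph

namespace TemperedPiChart

open CategoryTheory

variable {𝒢 : ProfiniteSemiGraph.{u}}

/-- **`C_{Π^tp_𝔾}(Π^tp_ℍ) = Π^tp_ℍ`** ([IUTchI] Prop. 2.2 p. 45, third inclusion; abc-iut-w4-d052's named target
`DecompSubgroupsCommensurablyTerminal`, one member): for `𝒢`, `𝒢_ℍ` FINITE coherent Prop-3.6 graphs, `𝒢`
with a closed edge, the cusp-omitted graph of anabelioids quasi-coherent with the vertices of `ℍ` elevated, and
a decomposition homomorphism `φ : π₁^temp(𝒢_ℍ) → π₁^temp(𝒢)` (`IsDecompHom`) along which open normal subgroups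
pull back COFINALLY, the decomposition subgroup `Π^tp_ℍ = range φ` is commensurably terminal in `π₁^temp(𝒢)`.
Chain at the chart model `ι = chartActionFin c` of the profinite completion: (P3)
`isCommensurablyTerminal_topologicalClosure_map_of_mem_decompSubgroups` ([SemiAnbd] Cor. 2.7 (i)), (P1)
`comap_topologicalClosure_map_range_eq_of_isDecompHom_of_cofinal` (M. Hall + André levels + cofinality), and
§1 (commensurators pass to closures).  The [IUTchI] sentence is a `[claim: Mochizuki2012, status: disputed]`
item; PROVED is the displayed statement. [cite: Mochizuki2012, IUTchI Prop 2.2 p.45] -/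
theorem isCommensurablyTerminal_range_of_isDecompHom_of_cofinal {H : 𝒢.graph.Subgraph}
    [Finite 𝒢.graph.Vertex] [Finite 𝒢.graph.Edge] [Finite (𝒢.restrict H).graph.Vertex]
    [Finite (𝒢.restrict H).graph.Edge] (h36 : 𝒢.Prop36Hypotheses) (hcoh : 𝒢.IsCoherent)
    (hcl : ∃ e : 𝒢.graph.Edge, 𝒢.graph.IsClosedEdge e) (h36' : (𝒢.restrict H).Prop36Hypotheses)
    (hcoh' : (𝒢.restrict H).IsCoherent)
    (hq : (𝒢.toAnab.restrict 𝒢.toAnab.graph.maximalSubgraph).IsQuasiCoherent)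
    (hel : ∀ v : H.toSemiGraph.Vertex,
      (𝒢.toAnab.restrict 𝒢.toAnab.graph.maximalSubgraph).IsElevated ⟨v.1, trivial⟩)
    (c : TemperedPiChart 𝒢) (c' : TemperedPiChart (𝒢.restrict H)) {φ : c'.G →ₜ* c.G}
    (hφ : c.IsDecompHom H c' φ)
    (hcof : ∀ N' : OpenNormalSubgroup c'.G, ∃ N : OpenNormalSubgroup c.G,
      N.toSubgroup.comap φ.toMonoidHom ≤ N'.toSubgroup) :
    AbsoluteAnabelian.IsCommensurablyTerminal φ.toMonoidHom.range := by
  haveI := c.isTopologicalGroup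
  -- the chart model of the profinite completion of `π₁^temp(𝒢)`
  have h𝒢 := isTempered_of_isFinite_of_prop36 h36
  obtain ⟨d⟩ := nonempty_chartVertexDatum h36 c
  have hfin : ∀ X : 𝒢.toAnab.BObj, Finite ((chartFibre c h𝒢).obj X) :=
    fun X => finite_chartFibre c h𝒢 d.v d.ψ d.e X
  have hι := isProfiniteCompletion_chartActionFin c h𝒢 hfin d
  exact isCommensurablyTerminal_of_topologicalClosure_map _
    (isCommensurablyTerminal_topologicalClosure_map_of_mem_decompSubgroups h36 h36' hq hel c hι
      hφ.range_mem)
    (comap_topologicalClosure_map_range_eq_of_isDecompHom_of_cofinal h36 hcoh hcl h36' hcoh' c c' hφ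
      hcof hι)

/-- **abc-iut-w4-d052's named target `DecompSubgroupsCommensurablyTerminal c ℍ`** ([IUTchI] Prop. 2.2, third
inclusion, for EVERY decomposition subgroup — they form one conjugacy class,
`decompSubgroupsCommensurablyTerminal_of_one`) **from ONE cofinal decomposition homomorphism**, under the
graph hypotheses above. [cite: Mochizuki2012, IUTchI Prop 2.2 p.45] -/
theorem decompSubgroupsCommensurablyTerminal_of_isDecompHom_of_cofinal {H : 𝒢.graph.Subgraph}
    [Finite 𝒢.graph.Vertex] [Finite 𝒢.graph.Edge] [Finite (𝒢.restrict H).graph.Vertex]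
    [Finite (𝒢.restrict H).graph.Edge] (h36 : 𝒢.Prop36Hypotheses) (hcoh : 𝒢.IsCoherent)
    (hcl : ∃ e : 𝒢.graph.Edge, 𝒢.graph.IsClosedEdge e) (h36' : (𝒢.restrict H).Prop36Hypotheses)
    (hcoh' : (𝒢.restrict H).IsCoherent)
    (hq : (𝒢.toAnab.restrict 𝒢.toAnab.graph.maximalSubgraph).IsQuasiCoherent)
    (hel : ∀ v : H.toSemiGraph.Vertex,
      (𝒢.toAnab.restrict 𝒢.toAnab.graph.maximalSubgraph).IsElevated ⟨v.1, trivial⟩)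
    (c : TemperedPiChart 𝒢) (c' : TemperedPiChart (𝒢.restrict H)) {φ : c'.G →ₜ* c.G}
    (hφ : c.IsDecompHom H c' φ)
    (hcof : ∀ N' : OpenNormalSubgroup c'.G, ∃ N : OpenNormalSubgroup c.G,
      N.toSubgroup.comap φ.toMonoidHom ≤ N'.toSubgroup) :
    c.DecompSubgroupsCommensurablyTerminal H :=
  decompSubgroupsCommensurablyTerminal_of_one hφ.range_mem
    (isCommensurablyTerminal_range_of_isDecompHom_of_cofinal h36 hcoh hcl h36' hcoh' hq hel c c' hφ hcof)

end TemperedPiChart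

end ProfiniteSemiGraph

end Literature.AnabelianGeometry.SemiGraphs
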